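import Mathlib
import HarnessLib

/-!
# The `(B-OD)` currency lemma WITH POTENTIAL (scalar algebra)

Support file for the crux `NearFlatRatioLaw` (line `ratepack_v2`, stub `stub_hODpot_A`; successor step (C)/(R5) of
`Cruxes/NearFlatRatioLaw/Lines/ratepack-v7-moments-g18.md` §14; memo v8 (g19)).

The moment twin of lane A's `…BOCoreCurrency.core_currency`.  Inputs (all real numbers):
(0) the integrated core `L²` estimate of `…CoreDefectRecordOrbitMomentsQuasi` in the shape `I ≤ 2Zi²A/(N̄(1−κ_P))·S + 2(Zi A κ_P)²/(N̄(1−κ_P))·M₂·P₂`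
    (`A = c₁a₀'` the fibre amplitude, `S = ∫dπ w·(slow side)`, `P₂ = ∫(∫|φ|ρ̄)² ≤ (ℓ/K₁)²‖φ‖²`, `ℓ = linkCE`);
(S) the evaluated slow/fibre side `S ≤ [G·(btC·K₁)·ℓ²·(X_φ‖φ‖² + X_ψ∫od²φ²) + 4η²·A·M₂·ℓ²‖φ‖²]/K₁²` (`…SlowSideFibreFactors` + `…RecordFibreFactor` +
    `…RecordReferenceMassRatio`: every fibre factor is `β^{-(a+k+j)}·ΞCr·btC·K₁`; `G = 40(1+η)ΞCr`, `X_φ = O(β^{-2/3})`, `X_ψ = O(1)` after the β-bookkeeping);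
(2) the central quasimode floor `(1−η)·A·M₂ ≤ btC·K₁`; (3) the norm floor `(1−κ_n)γ‖φ‖² ≤ T`; (4) the mass ratio `γ ≤ 2N̄M₂`; (5) `ℓ ≤ 2λ₀`.
Output ★★ `core_currency_pot`:
`I ≤ ((btC·Zi/γ)·λ₀)²·( [(16G X_φ/((1−κ_P)(1−η)) + (64η² + 16κ_P²)/((1−κ_P)(1−η)²))/(1−κ_n)]·T + [16G X_ψ/((1−κ_P)(1−η))]·(γ·∫od²φ²) )`
— the literal shape `Λ²(b²T + κ·γ·∫𝟙od²φ²)` of the stub `stub_hODpot_A` with `b² = O(X_φ + η² + κ_P²)` and `κ = O(X_ψ)`.  Pure real algebra.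
-/

noncomputable section

namespace Summit.QuantumFields.YangMills.Theorems.FemtoTransferGap.TwoLattice.ConstTube

set_option maxHeartbeats 800000 in
-- two `field_simp; ring` identities in 20 variables.
/-- ★★ **THE (B-OD) CURRENCY LEMMA WITH POTENTIAL** (see the module docstring). [folklore] -/
theorem core_currency_pot {I S P2 T Zi A Nbar M2in K₁ ℓ φ2 ψ2 btC η κP κn γ lam0 G Xφ Xψ : ℝ}
    (hZi : 0 < Zi) (hA : 0 ≤ A) (hN : 0 < Nbar) (hM : 0 < M2in) (hK₁ : 0 < K₁) (hℓ : 0 ≤ ℓ) (hφ2 : 0 ≤ φ2) (hψ2 : 0 ≤ ψ2)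
    (hη : η < 1) (hκP0 : 0 ≤ κP) (hκP : κP < 1) (hκn : κn < 1) (hγ : 0 < γ) (hG : 0 ≤ G) (hXφ : 0 ≤ Xφ) (hXψ : 0 ≤ Xψ)
    (h0 : I ≤ 2 * (Zi ^ 2 * A) / (Nbar * (1 - κP)) * S + 2 * (Zi * A * κP) ^ 2 / (Nbar * (1 - κP)) * M2in * P2)
    (hS : S ≤ (G * (btC * K₁) * ℓ ^ 2 * (Xφ * φ2 + Xψ * ψ2) + 4 * η ^ 2 * A * M2in * ℓ ^ 2 * φ2) / K₁ ^ 2)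
    (hP2 : P2 ≤ (ℓ / K₁) ^ 2 * φ2)
    (h2 : (1 - η) * A * M2in ≤ btC * K₁) (h3 : (1 - κn) * γ * φ2 ≤ T) (h4 : γ ≤ 2 * (Nbar * M2in)) (h5 : ℓ ≤ 2 * lam0) :
    I ≤ (btC * Zi / γ * lam0) ^ 2 *
      (((16 * G * Xφ / ((1 - κP) * (1 - η)) + (64 * η ^ 2 + 16 * κP ^ 2) / ((1 - κP) * (1 - η) ^ 2)) / (1 - κn)) * T +
        (16 * G * Xψ / ((1 - κP) * (1 - η))) * (γ * ψ2)) := by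
  have hη1 : 0 < 1 - η := by linarith
  have hκP1 : 0 < 1 - κP := by linarith
  have hκn1 : 0 < 1 - κn := by linarith
  have hlam : 0 ≤ lam0 := by linarith
  have hne1 : (1 - η) ≠ 0 := hη1.ne'
  have hne2 : (1 - κP) ≠ 0 := hκP1.ne'
  have hne3 : (1 - κn) ≠ 0 := hκn1.ne'
  have hne4 : Nbar ≠ 0 := hN.ne'
  have hne5 : M2in ≠ 0 := hM.ne'
  have hne6 : K₁ ≠ 0 := hK₁.ne'
  have hne7 : γ ≠ 0 := hγ.ne'
  set R : ℝ := btC * K₁ with hR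
  have hR0 : 0 ≤ R := le_trans (by positivity) h2
  have hbtC : 0 ≤ btC := by
    by_contra hneg
    rw [not_le] at hneg
    have := mul_neg_of_neg_of_pos hneg hK₁
    linarith
  -- the worst-case amplitude `A' = R/((1−η)M₂) ≥ A`
  set A' : ℝ := R / ((1 - η) * M2in) with hA'
  have hAA' : A ≤ A' := by rw [hA', le_div_iff₀ (by positivity)]; linarith [h2]
  have hA'0 : 0 ≤ A' := hA.trans hAA'
  -- step 1: insert (S) and (P₂) into (0)
  set B : ℝ := G * R * ℓ ^ 2 * (Xφ * φ2 + Xψ * ψ2) with hB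
  have hB0 : 0 ≤ B := by rw [hB]; positivity
  have h1 : I ≤ 2 * (Zi ^ 2 * A) / (Nbar * (1 - κP)) * ((B + 4 * η ^ 2 * A * M2in * ℓ ^ 2 * φ2) / K₁ ^ 2) +
      2 * (Zi * A * κP) ^ 2 / (Nbar * (1 - κP)) * M2in * ((ℓ / K₁) ^ 2 * φ2) := by
    have c1 : 0 ≤ 2 * (Zi ^ 2 * A) / (Nbar * (1 - κP)) := by positivity
    have c2 : 0 ≤ 2 * (Zi * A * κP) ^ 2 / (Nbar * (1 - κP)) * M2in := by positivity
    have i1 := mul_le_mul_of_nonneg_left hS c1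
    have i2 := mul_le_mul_of_nonneg_left hP2 c2
    linarith [h0, i1, i2]
  -- step 2: monotonicity in `A ≤ A'`
  have h2' : 2 * (Zi ^ 2 * A) / (Nbar * (1 - κP)) * ((B + 4 * η ^ 2 * A * M2in * ℓ ^ 2 * φ2) / K₁ ^ 2) +
      2 * (Zi * A * κP) ^ 2 / (Nbar * (1 - κP)) * M2in * ((ℓ / K₁) ^ 2 * φ2) ≤
      2 * (Zi ^ 2 * A') / (Nbar * (1 - κP)) * ((B + 4 * η ^ 2 * A' * M2in * ℓ ^ 2 * φ2) / K₁ ^ 2) +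
      2 * (Zi * A' * κP) ^ 2 / (Nbar * (1 - κP)) * M2in * ((ℓ / K₁) ^ 2 * φ2) := by
    gcongr
  -- step 3: evaluate at `A'`: a common factor `Zi²btC²ℓ²/(1−κP) · 1/(N̄M₂)`
  have e3 : 2 * (Zi ^ 2 * A') / (Nbar * (1 - κP)) * ((B + 4 * η ^ 2 * A' * M2in * ℓ ^ 2 * φ2) / K₁ ^ 2) +
      2 * (Zi * A' * κP) ^ 2 / (Nbar * (1 - κP)) * M2in * ((ℓ / K₁) ^ 2 * φ2) =
      (Zi ^ 2 * btC ^ 2 * ℓ ^ 2 / (1 - κP)) * (2 * G * (Xφ * φ2 + Xψ * ψ2) / (1 - η) + (8 * η ^ 2 + 2 * κP ^ 2) * φ2 / (1 - η) ^ 2) *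
        (1 / (Nbar * M2in)) := by
    rw [hA', hB, hR]
    field_simp
    ring
  -- step 4: the mass ratio `1/(N̄M₂) ≤ 2/γ` and `ℓ² ≤ 4λ₀²`
  have h4' : 1 / (Nbar * M2in) ≤ 2 / γ := by
    rw [div_le_div_iff₀ (by positivity) hγ]; linarith
  have hbr : 0 ≤ 2 * G * (Xφ * φ2 + Xψ * ψ2) / (1 - η) + (8 * η ^ 2 + 2 * κP ^ 2) * φ2 / (1 - η) ^ 2 := by positivity
  have hℓ2 : ℓ ^ 2 ≤ (2 * lam0) ^ 2 := pow_le_pow_left₀ hℓ h5 2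
  have h45 : (Zi ^ 2 * btC ^ 2 * ℓ ^ 2 / (1 - κP)) * (2 * G * (Xφ * φ2 + Xψ * ψ2) / (1 - η) + (8 * η ^ 2 + 2 * κP ^ 2) * φ2 / (1 - η) ^ 2) *
        (1 / (Nbar * M2in)) ≤
      (Zi ^ 2 * btC ^ 2 * (2 * lam0) ^ 2 / (1 - κP)) * (2 * G * (Xφ * φ2 + Xψ * ψ2) / (1 - η) + (8 * η ^ 2 + 2 * κP ^ 2) * φ2 / (1 - η) ^ 2) *
        (2 / γ) := by
    have i1 : Zi ^ 2 * btC ^ 2 * ℓ ^ 2 / (1 - κP) ≤ Zi ^ 2 * btC ^ 2 * (2 * lam0) ^ 2 / (1 - κP) :=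
      div_le_div_of_nonneg_right (mul_le_mul_of_nonneg_left hℓ2 (by positivity)) hκP1.le
    exact mul_le_mul (mul_le_mul_of_nonneg_right i1 hbr) h4' (by positivity) (by positivity)
  -- step 5: the literal currency, and the norm floor `γφ2 ≤ T/(1−κn)`
  have e5 : (Zi ^ 2 * btC ^ 2 * (2 * lam0) ^ 2 / (1 - κP)) * (2 * G * (Xφ * φ2 + Xψ * ψ2) / (1 - η) + (8 * η ^ 2 + 2 * κP ^ 2) * φ2 / (1 - η) ^ 2) *
        (2 / γ) =
      (btC * Zi / γ * lam0) ^ 2 *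
        (((16 * G * Xφ / ((1 - κP) * (1 - η)) + (64 * η ^ 2 + 16 * κP ^ 2) / ((1 - κP) * (1 - η) ^ 2))) * (γ * φ2) +
          (16 * G * Xψ / ((1 - κP) * (1 - η))) * (γ * ψ2)) := by
    field_simp
    ring
  have hcT : 0 ≤ (16 * G * Xφ / ((1 - κP) * (1 - η)) + (64 * η ^ 2 + 16 * κP ^ 2) / ((1 - κP) * (1 - η) ^ 2)) := by positivity
  have h3' : γ * φ2 ≤ T / (1 - κn) := by
    rw [le_div_iff₀ hκn1]; linarith [h3]
  have h6 : (btC * Zi / γ * lam0) ^ 2 *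
        (((16 * G * Xφ / ((1 - κP) * (1 - η)) + (64 * η ^ 2 + 16 * κP ^ 2) / ((1 - κP) * (1 - η) ^ 2))) * (γ * φ2) +
          (16 * G * Xψ / ((1 - κP) * (1 - η))) * (γ * ψ2)) ≤
      (btC * Zi / γ * lam0) ^ 2 *
        (((16 * G * Xφ / ((1 - κP) * (1 - η)) + (64 * η ^ 2 + 16 * κP ^ 2) / ((1 - κP) * (1 - η) ^ 2)) / (1 - κn)) * T +
          (16 * G * Xψ / ((1 - κP) * (1 - η))) * (γ * ψ2)) := by
    refine mul_le_mul_of_nonneg_left (add_le_add ?_ le_rfl) (sq_nonneg _)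
    calc (16 * G * Xφ / ((1 - κP) * (1 - η)) + (64 * η ^ 2 + 16 * κP ^ 2) / ((1 - κP) * (1 - η) ^ 2)) * (γ * φ2)
        ≤ (16 * G * Xφ / ((1 - κP) * (1 - η)) + (64 * η ^ 2 + 16 * κP ^ 2) / ((1 - κP) * (1 - η) ^ 2)) * (T / (1 - κn)) :=
          mul_le_mul_of_nonneg_left h3' hcT
      _ = (16 * G * Xφ / ((1 - κP) * (1 - η)) + (64 * η ^ 2 + 16 * κP ^ 2) / ((1 - κP) * (1 - η) ^ 2)) / (1 - κn) * T := by
          field_simp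
  calc I ≤ _ := h1
    _ ≤ _ := h2'
    _ = _ := e3
    _ ≤ _ := h45
    _ = _ := e5
    _ ≤ _ := h6

end Summit.QuantumFields.YangMills.Theorems.FemtoTransferGap.TwoLattice.ConstTube

end
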